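import Literature.Barriers.CriticalPhenomena.PlaquetteWalkKissLoopNoSeparator
import HarnessLib

/-!
# Barrier catalogue (SAWScalingLimit): the jump of the kiss loop's winding number across ANY of its edges («KISS LOOP EDGE JUMP»)

`Z → ∞` limit model of the printed Yang–Baxter weights [GlazmanManolescu2019, §1, eq. (1)]; LOBE programme of the «RECTANGLE COEFFICIENT» line (b-engine-1 g25,
DESIGN-next-g25 §2quater, TARGET M1′). ★★ `YBWalk.windK_jump_edge`: the general-edge form of `windK_jump_core` — a segment `ℓ r` crossing the closed edge `k`
of the kiss loop transversally (its start strictly left of the line `ℓ r`… precisely `segSide ℓ r (vertex k) > 0 > segSide ℓ r (vertex k+1)`), and missing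
every other closed edge, has `windK ℓ − windK r = 1`. This is the local rule «wind(left) − wind(right) = 1 across every edge» from which the uniform chirality
of lobe corners follows (DESIGN §2quater). [AhlforsCA1979, Ch. 4 §2.1] [CourantRobbins1958, Ch. V Appendix §2]
-/

noncomputable section

open Set Function Complex
open Literature.Topology.PlaneTopology

namespace Literature.Probability.RandomPlanarGeometry.SAW.YangBaxter

open private mem_segment_toC eq_of_mem_crossSeg eq_side_of_mem_crossSeg_arcSeg eq_face_of_mem_arcSeg eq_innerPt_of_mem_crossSeg_arcSeg
  arcSeg_disjoint_faceBox crossSeg_faceBox segment_subset_faceBox crossSeg_side_eq crossSeg_side_eq' lineMap_toC_add_sub_half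
  from Literature.Probability.RandomPlanarGeometry.YangBaxterSAWExcursionJordan

namespace YBWalk

variable {D : Set Face} {a z : MidEdge} {γ : YBWalk D a z} {ta tb : ℕ}

/-- The vertex list is nonempty. [folklore] -/
private theorem kList_pos'' : 0 < (γ.kList ta tb).length := by rw [length_kList, kN]; omega

/-- The cyclically next vertex. [folklore] -/
private theorem kList_getElem_succ'' (k : ℕ) :
    (γ.kList ta tb)[(k + 1) % (γ.kList ta tb).length]'(Nat.mod_lt _ kList_pos'') = toC (γ.kPt ta ((k + 1) % kN ta tb)) := by
  rw [kList_getElem]; simp only [length_kList]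

/-- ★★ **The jump of the kiss loop's winding number across an arbitrary closed edge.** If a segment `ℓ r` crosses the closed edge `k` (from vertex `k` to vertex
`k + 1 mod N`) transversally — vertex `k` strictly on the positive side of the line `ℓ r`, vertex `k+1` strictly on the negative side, the two segments
meeting in the open segment `ℓ r` — and misses every other closed edge, then `windK ℓ − windK r = 1` («left minus right is one»).
[cite: AhlforsCA1979, Ch. 4 §2.1 (index of a point with respect to a closed curve)] [cite: CourantRobbins1958, Ch. V Appendix §2 (polygons: the even–odd rule)] -/
theorem windK_jump_edge (hab : ta < tb) {k : ℕ} (hk : k < kN ta tb) {ℓ r : ℂ}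
    (hmiss : ∀ k', k' < kN ta tb → k' ≠ k → ∀ x ∈ γ.kEdge ta tb k', x ∉ segment ℝ ℓ r)
    (hA : 0 < segSide ℓ r (toC (γ.kPt ta k))) (hB : segSide ℓ r (toC (γ.kPt ta ((k + 1) % kN ta tb))) < 0)
    (hx : ∃ p ∈ segment ℝ (toC (γ.kPt ta k)) (toC (γ.kPt ta ((k + 1) % kN ta tb))), p ∈ openSegment ℝ ℓ r) :
    γ.windK ta tb ℓ - γ.windK ta tb r = 1 := by
  set l := γ.kList ta tb with hl
  set N := kN ta tb with hN
  have hN2 : N = 2 * (tb - ta) + 1 := rfl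
  have hlen : l.length = N := length_kList
  have hl0 : l ≠ [] := List.ne_nil_of_length_pos kList_pos''
  have hN3 : 3 ≤ N := by omega
  have hNr : (0 : ℝ) < N := by exact_mod_cast (show 0 < N by omega)
  have hlenR : ((l.length : ℕ) : ℝ) = N := by rw [hlen]
  set u : ℝ := (k : ℝ) / N with hu
  set u' : ℝ := ((k : ℝ) + 1) / N with hu'
  have hkR : (k : ℝ) + 1 ≤ N := by exact_mod_cast hk
  have hu0 : 0 ≤ u := div_nonneg (by positivity) hNr.le
  have huu : u < u' := by rw [hu, hu']; exact div_lt_div_of_pos_right (by linarith) hNr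
  have hu1 : u' ≤ 1 := by rw [hu', div_le_one hNr]; exact hkR
  set L : ℝ → ℂ := polygonLoop l with hL
  -- the two vertices of the edge
  have eA : l[k]'(by rw [hlen]; exact hk) = toC (γ.kPt ta k) := kList_getElem _
  have hLu : L u = toC (γ.kPt ta k) := by
    have e := polygonLoop_vertex (l := l) (k := k) (by rw [hlen]; exact hk)
    rw [hlenR] at e; rw [hL, hu, e, eA]
  have hLu' : L u' = toC (γ.kPt ta ((k + 1) % N)) := by
    have e := polygonLoop_apply_div (l := l) (k := k) (by rw [hlen]; exact hk) (θ := 1) ⟨zero_le_one, le_rfl⟩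
    rw [hlenR, AffineMap.lineMap_apply_one, kList_getElem_succ''] at e
    rw [hL, hu', e]
  -- the edge is straight
  have hmid : ∀ s ∈ Icc u u', L s = AffineMap.lineMap (L u) (L u') ((s - u) / (u' - u)) := by
    intro s hs
    have hd : u' - u = 1 / N := by rw [hu, hu']; field_simp; ring
    have hθ : (s - u) / (u' - u) ∈ Icc (0 : ℝ) 1 :=
      ⟨div_nonneg (by linarith [hs.1]) (by linarith), (div_le_one (by linarith)).2 (by linarith [hs.2])⟩
    have hsu : s = ((k : ℕ) + (s - u) / (u' - u)) / (l.length : ℝ) := by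
      rw [hlenR, hd]; field_simp; rw [hu]; field_simp; ring
    have e := polygonLoop_apply_div (l := l) (k := k) (by rw [hlen]; exact hk) hθ
    rw [← hsu, eA, kList_getElem_succ''] at e
    rw [hL] at hLu hLu' ⊢
    rw [e, hLu, hLu']
  -- off the edge, the loop runs through the other closed edges
  have hout : ∀ s ∈ Icc 0 u ∪ Icc u' 1, L s ∉ segment ℝ ℓ r := by
    intro s hs hmem
    -- `L s` lies on some closed edge `k' ≠ k`
    have haux : ∃ k', k' < N ∧ k' ≠ k ∧ L s ∈ γ.kEdge ta tb k' := by
      obtain ⟨k', hk', θ, hθ, hks, hv⟩ := polygonLoop_eq_of_floor hl0 s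
      rw [hlen] at hk'
      have hedge : L s ∈ γ.kEdge ta tb k' := by
        rw [hL, hv, kList_getElem, kList_getElem_succ'', kEdge, segment_eq_image_lineMap]
        exact ⟨θ, ⟨hθ.1, hθ.2.le⟩, rfl⟩
      by_cases hkk : k' = k
      · -- on the crossed edge: only at its two vertices, which lie on the neighbouring edges
        subst hkk
        rcases hs with hs | hs
        · -- s ≤ u = k/N: then fract s = s and (k + θ)/N = s ≤ k/N ⇒ θ = 0 ⇒ vertex k ∈ edge k-1
          have hs1 : s < 1 := lt_of_le_of_lt hs.2 (lt_of_lt_of_le huu hu1)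
          have hfr : Int.fract s = s := Int.fract_eq_self.2 ⟨hs.1, hs1⟩
          rw [hfr, hlen] at hks
          have hθ0 : θ = 0 := by
            have : ((k' : ℝ) + θ) / N ≤ k' / N := by rw [hks]; exact hs.2
            rw [div_le_div_iff_of_pos_right hNr] at this
            linarith [hθ.1]
          have hLs : L s = toC (γ.kPt ta k') := by rw [hL, hv, hθ0, AffineMap.lineMap_apply_zero, kList_getElem]
          rcases Nat.eq_zero_or_pos k' with h0 | hpos
          · subst h0
            refine ⟨N - 1, by omega, by omega, ?_⟩
            rw [hLs, kEdge, show N - 1 + 1 = N by omega, ← hN, Nat.mod_self]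
            exact right_mem_segment _ _ _
          · refine ⟨k' - 1, by omega, by omega, ?_⟩
            rw [hLs, kEdge, show k' - 1 + 1 = k' by omega, ← hN, Nat.mod_eq_of_lt hk']
            exact right_mem_segment _ _ _
        · -- s ≥ u' = (k+1)/N: if s < 1 then ⌊N s⌋ ≥ k+1 > k' = k contradiction unless…; if s = 1 then L 1 = vertex 0
          rcases eq_or_lt_of_le hs.2 with hs1 | hs1
          · -- s = 1: L 1 = L 0 = vertex 0, the end of the edge N - 1 (≠ k unless k = N-1, then use edge 0… but k = k' = ⌊N·fract 1⌋ = 0)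
            have hk0 : k' = 0 := by
              rw [hs1, Int.fract_one] at hks
              have : ((k' : ℝ) + θ) = 0 := by
                have := hks; rw [div_eq_zero_iff] at this
                rcases this with h | h
                · exact h
                · rw [hlen] at h; exact absurd h hNr.ne'
              have : (k' : ℝ) = 0 := by linarith [hθ.1, show (0 : ℝ) ≤ k' from Nat.cast_nonneg _]
              exact_mod_cast this
            subst hk0
            refine ⟨N - 1, by omega, by omega, ?_⟩
            have e1 : L s = toC (γ.kPt ta 0) := by
              rw [hs1]
              have : L 1 = L 0 := by rw [hL]; simpa using periodic_polygonLoop l 0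
              rw [this, hL]
              have e := polygonLoop_vertex (l := l) (k := 0) kList_pos''
              rw [Nat.cast_zero, zero_div] at e
              rw [e, kList_getElem]
            rw [e1, kEdge, show N - 1 + 1 = N by omega, ← hN, Nat.mod_self]
            exact right_mem_segment _ _ _
          · have hfr : Int.fract s = s := Int.fract_eq_self.2 ⟨le_trans (le_trans hu0 huu.le) hs.1, hs1⟩
            rw [hfr, hlen] at hks
            exfalso
            have h1 : ((k' : ℝ) + 1) / N ≤ ((k' : ℝ) + θ) / N := by rw [hks]; exact hs.1
            rw [div_le_div_iff_of_pos_right hNr] at h1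
            linarith [hθ.2]
      · exact ⟨k', hk', hkk, hedge⟩
    obtain ⟨k', hk', hkk, hLs⟩ := haux
    exact hmiss k' hk' hkk _ hLs hmem
  have key := wind_sub_wind_of_straight_cross (L := L) (a := 0) (u := u) (u' := u') (b := 1)
    (ℓ := ℓ) (r := r) hu0 huu hu1
    ((continuous_polygonLoop l).continuousOn) (by rw [hL]; simpa using (periodic_polygonLoop l 0).symm)
    hmid hout (by rw [hLu]; exact hA) (by rw [hLu']; exact hB) (by rw [hLu, hLu']; exact hx)
  simpa [windK] using key

/-! ## §2 Lobe kisses: no jump between the before-part and the after-part -/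

/-- Two lattice segments in one frame: common points give affine parameters. [folklore] -/
private theorem seg_meet_params'' {b A B C E : ℤ × ℤ} {x : ℂ} (h1 : x ∈ segment ℝ (toC (b + A)) (toC (b + B)))
    (h2 : x ∈ segment ℝ (toC (b + C)) (toC (b + E))) :
    ∃ t t' : ℝ, 0 ≤ t ∧ t ≤ 1 ∧ 0 ≤ t' ∧ t' ≤ 1 ∧
      (A.1 : ℝ) + t * ((B.1 : ℝ) - A.1) = C.1 + t' * ((E.1 : ℝ) - C.1) ∧
      (A.2 : ℝ) + t * ((B.2 : ℝ) - A.2) = C.2 + t' * ((E.2 : ℝ) - C.2) := by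
  obtain ⟨t, h0, h1', hx, hy⟩ := mem_segment_toC h1
  obtain ⟨t', h0', h1'', hx', hy'⟩ := mem_segment_toC h2
  refine ⟨t, t', h0, h1', h0', h1'', ?_, ?_⟩
  · have := hx.symm.trans hx'; simp only [Prod.fst_add, Int.cast_add] at this; linarith
  · have := hy.symm.trans hy'; simp only [Prod.snd_add, Int.cast_add] at this; linarith

/-- The sides of a LOBE kiss: `s₂ ∉ {s₁, s₁.opp}`, `s₃ = s₁.opp`, `s₄ = s₂.opp`. [cite: GlazmanManolescu2019, §1, Fig. 1 (the configurations `w₁`, `w₂`)] -/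
theorem lobe_sides (hta : ta < γ.arcs.length) (htb : tb < γ.arcs.length) (hne : ta ≠ tb) (hkiss : γ.fc tb = γ.fc ta)
    (hlobe : γ.sIn tb = (γ.sIn ta).opp) :
    γ.sOut ta ≠ γ.sIn ta ∧ γ.sOut ta ≠ (γ.sIn ta).opp ∧ γ.sOut tb = (γ.sOut ta).opp := by
  obtain ⟨h0, h1, h2, h3, h4⟩ := γ.not_straight_of_two_arcs hta htb hne hkiss
  have h5 := (γ.side_sIn_nth hta).2.2
  have h6 := (γ.side_sIn_nth htb).2.2
  revert h0 h1 h2 h3 h4 h5 h6 hlobe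
  cases γ.sIn ta <;> cases γ.sOut ta <;> cases γ.sIn tb <;> cases γ.sOut tb <;> decide

/-- Coordinates for the lobe path, segment A (side midpoint → corner between `s₁` and `s₄ = s₂.opp`) against the four loop pieces in the kiss plaquette
(first arc, chord, exit crossing, entry crossing). [folklore] -/
private theorem lobeA_clear (s₁ s₂ : Side) (h1 : s₂ ≠ s₁) (h2 : s₂ ≠ s₁.opp) {t t' : ℝ} (ht0 : 0 ≤ t) (ht1 : t ≤ 1) (hu0 : 0 ≤ t') (hu1 : t' ≤ 1)
    {C E : ℤ × ℤ}
    (hCE : (C = s₁.inOff ∧ E = s₂.inOff) ∨ (C = s₁.opp.inOff ∧ E = s₁.inOff) ∨ (C = s₂.inOff ∧ E = s₂.offset - s₂.nIn) ∨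
      (C = s₁.opp.inOff ∧ E = s₁.opp.offset - s₁.opp.nIn))
    (ex : (s₁.offset.1 : ℝ) + t * (((s₁.inOff + s₂.opp.inOff - ((2 : ℤ), (2 : ℤ))).1 : ℝ) - s₁.offset.1) = C.1 + t' * ((E.1 : ℝ) - C.1))
    (ey : (s₁.offset.2 : ℝ) + t * (((s₁.inOff + s₂.opp.inOff - ((2 : ℤ), (2 : ℤ))).2 : ℝ) - s₁.offset.2) = C.2 + t' * ((E.2 : ℝ) - C.2)) :
    False := by
  rcases hCE with ⟨rfl, rfl⟩ | ⟨rfl, rfl⟩ | ⟨rfl, rfl⟩ | ⟨rfl, rfl⟩ <;>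
    cases s₁ <;> cases s₂ <;> (try exact absurd rfl h1) <;> (try exact absurd rfl h2) <;>
    · dsimp only [Side.inOff, Side.offset, Side.nIn, Side.opp, Prod.mk_add_mk, Prod.mk_sub_mk, Prod.fst, Prod.snd] at ex ey
      push_cast at ex ey
      ring_nf at ex ey
      linarith

/-- Coordinates for the lobe path, segment B (corner between `s₁` and `s₄` → inner point of `s₄ = s₂.opp`) against the four loop pieces. [folklore] -/
private theorem lobeB_clear (s₁ s₂ : Side) (h1 : s₂ ≠ s₁) (h2 : s₂ ≠ s₁.opp) {t t' : ℝ} (_ht0 : 0 ≤ t) (ht1 : t ≤ 1) (hu0 : 0 ≤ t') (_hu1 : t' ≤ 1)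
    {C E : ℤ × ℤ}
    (hCE : (C = s₁.inOff ∧ E = s₂.inOff) ∨ (C = s₁.opp.inOff ∧ E = s₁.inOff) ∨ (C = s₂.inOff ∧ E = s₂.offset - s₂.nIn) ∨
      (C = s₁.opp.inOff ∧ E = s₁.opp.offset - s₁.opp.nIn))
    (ex : ((s₁.inOff + s₂.opp.inOff - ((2 : ℤ), (2 : ℤ))).1 : ℝ) + t * ((s₂.opp.inOff.1 : ℝ) - (s₁.inOff + s₂.opp.inOff - ((2 : ℤ), (2 : ℤ))).1) =
      C.1 + t' * ((E.1 : ℝ) - C.1))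
    (ey : ((s₁.inOff + s₂.opp.inOff - ((2 : ℤ), (2 : ℤ))).2 : ℝ) + t * ((s₂.opp.inOff.2 : ℝ) - (s₁.inOff + s₂.opp.inOff - ((2 : ℤ), (2 : ℤ))).2) =
      C.2 + t' * ((E.2 : ℝ) - C.2)) :
    False := by
  rcases hCE with ⟨rfl, rfl⟩ | ⟨rfl, rfl⟩ | ⟨rfl, rfl⟩ | ⟨rfl, rfl⟩ <;>
    cases s₁ <;> cases s₂ <;> (try exact absurd rfl h1) <;> (try exact absurd rfl h2) <;>
    · dsimp only [Side.inOff, Side.offset, Side.nIn, Side.opp, Prod.mk_add_mk, Prod.mk_sub_mk, Prod.fst, Prod.snd] at ex ey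
      push_cast at ex ey
      ring_nf at ex ey
      linarith

/-- ★★ **No jump for a LOBE kiss**: if the second visit enters through the side opposite to the first ENTRY (the loop leaves and returns through adjacent sides),
the kiss loop's winding number at the last before-point `ptOut (ta − 1)` equals its value at the first after-point `ptOut tb` — the before-part and the
after-part lie on the same side of the loop. [cite: AhlforsCA1979, Ch. 4 §2.1] [cite: CourantRobbins1958, Ch. V Appendix §2 (polygons)]
[cite: GlazmanManolescu2019, §1, Fig. 1 (the configurations `w₁`, `w₂`)] -/
theorem windK_lobe_no_jump (hab : ta < tb) (htb : tb < γ.arcs.length) (hkiss : γ.fc tb = γ.fc ta) (h1 : 1 ≤ ta)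
    (hlobe : γ.sIn tb = (γ.sIn ta).opp) :
    γ.windK ta tb (toC (γ.ptOut (ta - 1))) = γ.windK ta tb (toC (γ.ptOut tb)) := by
  have hta : ta < γ.arcs.length := by omega
  obtain ⟨hs21, hs21', hs4⟩ := lobe_sides hta htb (by omega) hkiss hlobe
  set b := (γ.fc ta).base with hb
  obtain ⟨hin, hout, -⟩ := γ.side_sIn_nth hta
  obtain ⟨-, houtp, -⟩ := γ.side_sIn_nth (i := ta - 1) (by omega)
  rw [show ta - 1 + 1 = ta by omega] at houtp
  obtain ⟨hinb, houtb, -⟩ := γ.side_sIn_nth htb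
  rw [hkiss] at hinb houtb
  have hface : γ.fc (ta - 1) ≠ γ.fc ta := by
    have := γ.fc_succ_ne (i := ta - 1) (by omega); rwa [show ta - 1 + 1 = ta by omega] at this
  have hnIn' : (γ.sIn ta).nIn = -(γ.sOut (ta - 1)).nIn := nIn_eq_neg_of_side_eq (houtp.trans hin.symm) hface
  have hnIn : (γ.sOut (ta - 1)).nIn = -(γ.sIn ta).nIn := by rw [hnIn', neg_neg]
  have eM : midPt (γ.nth ta) = b + (γ.sIn ta).offset := by rw [← hin, midPt_side]
  have ePout : γ.ptOut (ta - 1) = b + ((γ.sIn ta).offset - (γ.sIn ta).nIn) := by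
    rw [YBWalk.ptOut, innerPt_eq, houtp, hnIn, ← hin, midPt_side, hb]; abel
  have ePtb : γ.ptOut tb = b + (γ.sOut tb).inOff := by rw [YBWalk.ptOut, hkiss]; rfl
  -- the loop pieces inside the closed kiss plaquette
  have hloc : ∀ k, k < kN ta tb → ∀ x ∈ γ.kEdge ta tb k, x ∈ faceBox (γ.fc ta) →
      ∃ C E : ℤ × ℤ, ((C = (γ.sIn ta).inOff ∧ E = (γ.sOut ta).inOff) ∨ (C = (γ.sIn ta).opp.inOff ∧ E = (γ.sIn ta).inOff) ∨
        (C = (γ.sOut ta).inOff ∧ E = (γ.sOut ta).offset - (γ.sOut ta).nIn) ∨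
        (C = (γ.sIn ta).opp.inOff ∧ E = (γ.sIn ta).opp.offset - (γ.sIn ta).opp.nIn)) ∧
        x ∈ segment ℝ (toC (b + C)) (toC (b + E)) := by
    intro k hk x hxk hxb
    rcases mem_kEdge_cases hab htb hkiss hk hxk with ⟨i, hi, ha⟩ | ⟨i, hi, hc⟩ | hch
    · by_cases hF : γ.fc (ta + i) = γ.fc ta
      · have hi0 : i = 0 := by
          by_contra hne
          obtain ⟨-, e1, e2, -, -⟩ := γ.not_straight_of_two_arcs hta (show ta + i < γ.arcs.length by omega) (by omega) hF
          obtain ⟨-, e1', e2', -, -⟩ := γ.not_straight_of_two_arcs htb (show ta + i < γ.arcs.length by omega) (by omega) (hF.trans hkiss.symm)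
          rcases side_mem_of_kiss hta htb (by omega) hkiss (γ.sIn (ta + i)) with e | e | e | e
          · exact e1 e
          · exact e2 e
          · exact e1' e
          · exact e2' e
        subst hi0
        rw [Nat.add_zero, arcSeg] at ha
        exact ⟨_, _, Or.inl ⟨rfl, rfl⟩, ha⟩
      · exact absurd hxb (fun hb' => arcSeg_disjoint_faceBox hF ha hb')
    · obtain ⟨s, hs⟩ := crossSeg_faceBox hc hxb
      have hm : ta + i + 1 = ta + 1 ∨ ta + i + 1 = tb := by
        rcases side_mem_of_kiss hta htb (by omega) hkiss s with e | e | e | e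
        · rw [e, hin] at hs; have := γ.nth_inj (by omega) (by omega) hs; omega
        · rw [e, hout] at hs; have := γ.nth_inj (by omega) (by omega) hs; omega
        · rw [e, hinb] at hs; have := γ.nth_inj (by omega) (by omega) hs; omega
        · rw [e, houtb] at hs; have := γ.nth_inj (by omega) (by omega) hs; omega
      rcases hm with e | e
      · rw [e, ← hout, crossSeg_side_eq'] at hc; exact ⟨_, _, Or.inr (Or.inr (Or.inl ⟨rfl, rfl⟩)), hc⟩
      · rw [e, ← hinb, crossSeg_side_eq', hlobe] at hc; exact ⟨_, _, Or.inr (Or.inr (Or.inr ⟨rfl, rfl⟩)), hc⟩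
    · rw [arcSeg, hlobe] at hch; exact ⟨_, _, Or.inr (Or.inl ⟨rfl, rfl⟩), hch⟩
  -- (a) the outer half-crossing `ptOut (ta-1) → midPt (nth ta)` (as for separators)
  have hA : γ.windK ta tb (toC (γ.ptOut (ta - 1))) = γ.windK ta tb (toC (midPt (γ.nth ta))) := by
    refine windK_eq_of_segment fun x hx k hk hxk => ?_
    rw [ePout, eM] at hx
    have hxc : x ∈ crossSeg (γ.nth ta) := by
      rw [← hin, crossSeg_side_eq', segment_symm]
      rw [hb] at hx
      refine (convex_segment _ _).segment_subset (left_mem_segment _ _ _) ?_ hx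
      rw [segment_eq_image_lineMap]
      refine ⟨1 / 2, ⟨by norm_num, by norm_num⟩, ?_⟩
      rw [show (γ.fc ta).base + ((γ.sIn ta).offset - (γ.sIn ta).nIn) = ((γ.fc ta).base + (γ.sIn ta).offset) + (-(γ.sIn ta).nIn) by abel,
        show (γ.fc ta).base + (γ.sIn ta).inOff = ((γ.fc ta).base + (γ.sIn ta).offset) - (-(γ.sIn ta).nIn) by rw [Side.inOff]; abel]
      exact lineMap_toC_add_sub_half _ _
    rcases mem_kEdge_cases hab htb hkiss hk hxk with ⟨i, hi, ha⟩ | ⟨i, hi, hc⟩ | hch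
    · obtain ⟨e1, e2, -⟩ := γ.side_sIn_nth (show ta + i < γ.arcs.length by omega)
      rcases eq_side_of_mem_crossSeg_arcSeg hxc ha with e | e
      · rw [e1] at e; have := γ.nth_inj (by omega) (by omega) e
        have hi0 : i = 0 := by omega
        subst hi0
        rw [Nat.add_zero] at ha
        have hpt := eq_innerPt_of_mem_crossSeg_arcSeg (γ.side_sIn_nth hta).2.2 (by rw [hin]; exact hxc) ha
        rw [hpt, innerPt] at hx
        obtain ⟨t, t', h0, h1', h0', h1'', ex, ey⟩ := seg_meet_params'' hx (left_mem_segment ℝ (toC (b + (γ.sIn ta).inOff)) (toC (b + (γ.sIn ta).inOff)))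
        cases hs : γ.sIn ta <;> simp only [hs, Side.inOff, Side.offset, Side.nIn, Prod.fst_add, Prod.snd_add, Prod.fst_sub, Prod.snd_sub,
          Int.cast_add, Int.cast_sub, Int.cast_neg, Int.cast_ofNat, Int.cast_one, Int.cast_zero] at ex ey <;> linarith
      · rw [e2] at e; have := γ.nth_inj (by omega) (by omega) e; omega
    · have := γ.nth_inj (by omega) (by omega) (eq_of_mem_crossSeg hxc hc); omega
    · have hch' : x ∈ arcSeg (γ.fc ta) (γ.sIn ta) (γ.sIn tb) := by rw [arcSeg, segment_symm]; exact hch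
      obtain ⟨-, e1, -, -, -⟩ := γ.not_straight_of_two_arcs hta htb (by omega) hkiss
      have hpt := eq_innerPt_of_mem_crossSeg_arcSeg (Ne.symm e1) (by rw [hin]; exact hxc) hch'
      rw [hpt, innerPt] at hx
      obtain ⟨t, t', h0, h1', h0', h1'', ex, ey⟩ := seg_meet_params'' hx (left_mem_segment ℝ (toC (b + (γ.sIn ta).inOff)) (toC (b + (γ.sIn ta).inOff)))
      cases hs : γ.sIn ta <;> simp only [hs, Side.inOff, Side.offset, Side.nIn, Prod.fst_add, Prod.snd_add, Prod.fst_sub, Prod.snd_sub,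
        Int.cast_add, Int.cast_sub, Int.cast_neg, Int.cast_ofNat, Int.cast_one, Int.cast_zero] at ex ey <;> linarith
  -- (b) side midpoint → corner between s₁ and s₄, (c) corner → ptOut tb
  have hObd : ∀ s : Side, 0 ≤ s.offset.1 ∧ s.offset.1 ≤ 4 ∧ 0 ≤ s.offset.2 ∧ s.offset.2 ≤ 4 := by decide
  have hIbd : ∀ s : Side, 0 ≤ s.inOff.1 ∧ s.inOff.1 ≤ 4 ∧ 0 ≤ s.inOff.2 ∧ s.inOff.2 ≤ 4 := by decide
  have hVbd : ∀ s₁ s₃ : Side, 0 ≤ (s₁.inOff + s₃.inOff - ((2 : ℤ), (2 : ℤ))).1 ∧ (s₁.inOff + s₃.inOff - ((2 : ℤ), (2 : ℤ))).1 ≤ 4 ∧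
      0 ≤ (s₁.inOff + s₃.inOff - ((2 : ℤ), (2 : ℤ))).2 ∧ (s₁.inOff + s₃.inOff - ((2 : ℤ), (2 : ℤ))).2 ≤ 4 := by decide
  set V : ℤ × ℤ := (γ.sIn ta).inOff + (γ.sOut ta).opp.inOff - (2, 2) with hV
  have hB : γ.windK ta tb (toC (midPt (γ.nth ta))) = γ.windK ta tb (toC (b + V)) := by
    refine windK_eq_of_segment fun x hx k hk hxk => ?_
    rw [eM] at hx
    have hxb : x ∈ faceBox (γ.fc ta) := segment_subset_faceBox _ (hObd _) (hVbd _ _) hx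
    obtain ⟨C, E, hCE, hp⟩ := hloc k hk x hxk hxb
    obtain ⟨t, t', h0, h1', h0', h1'', ex, ey⟩ := seg_meet_params'' hx hp
    exact lobeA_clear _ _ hs21 hs21' h0 h1' h0' h1'' hCE ex ey
  have hC : γ.windK ta tb (toC (b + V)) = γ.windK ta tb (toC (γ.ptOut tb)) := by
    refine windK_eq_of_segment fun x hx k hk hxk => ?_
    rw [ePtb, hs4] at hx
    have hxb : x ∈ faceBox (γ.fc ta) := segment_subset_faceBox _ (hVbd _ _) (hIbd _) hx
    obtain ⟨C, E, hCE, hp⟩ := hloc k hk x hxk hxb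
    obtain ⟨t, t', h0, h1', h0', h1'', ex, ey⟩ := seg_meet_params'' hx hp
    exact lobeB_clear _ _ hs21 hs21' h0 h1' h0' h1'' hCE ex ey
  rw [hA, hB, hC]

end YBWalk

end Literature.Probability.RandomPlanarGeometry.SAW.YangBaxter
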